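import Mathlib.Analysis.InnerProductSpace.PiL2
import Mathlib.Analysis.Normed.Lp.MeasurableSpace
import Literature.Probability.Process.PointStationaryLaw
import HarnessLib

/-!
# Mecke with a translation-covariant mark (stub T1 `stub_covariantMecke` of line `palm-good-law`,
# crux `ReggeStarCoercivity.DefectFreeCrystallizes`, stmt-AtomisticToContinuum-13603)

**Theorem** (`stub_covariantMecke`).  Let `P` be a point-stationary law (`IsPointStationaryLaw`,
the Mecke / mass-transport identity) on configurations `μ : Measure ℝ³`, let
`C ⊆ (configuration, point)` be a measurable mark which is COVARIANT at the root,
`(θ_y μ, -y) ∈ C ↔ (μ, 0) ∈ C` (`θ_y μ = μ.map (· - y)`: "`y` is marked in `μ`", re-rooted at `y`,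
reads "the root is marked"), and let `w : ℝ³ → ℝ≥0∞` be an even measurable weight.  Then the
expected weighted number of marked points equals the expected weight mass on the event that the
ROOT is marked: `E_P[Σ_y w(y) 1_C(μ, y)] = E_P[1_{(μ, 0) ∈ C} · ∫ w dμ]`.

**Proof.**  Apply the Mecke identity to the jointly measurable mark
`g(μ, y) = 1_C(μ, y) · w(y)` (`Function.uncurry g = C.indicator (w ∘ snd)`).  On the right-hand side
`g(θ_y μ, -y) = 1_C(θ_y μ, -y) · w(-y) = 1_{(μ, 0) ∈ C} · w(y)` by covariance and evenness, and the
constant `1_{(μ, 0) ∈ C}` comes out of the inner integral (`lintegral_const_mul`).  All `[folklore]`.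
-/

noncomputable section

open MeasureTheory
open scoped ENNReal

namespace Summit.AtomisticToContinuum.Crystallization.Theorems.PalmGoodLaw.CovariantMecke

open Literature.Probability.Process

/-- **stub_covariantMecke** (T1 of line `palm-good-law`): MECKE WITH A TRANSLATION-COVARIANT MARK.
For a point-stationary law `P`, a measurable mark `C ⊆ (configuration, point)` covariant at the
root (`(θ_y μ, -y) ∈ C ↔ (μ, 0) ∈ C`) and an even measurable weight `w`,
`E_P[Σ_y w(y) 1_C(μ, y)] = E_P[1_{(μ, 0) ∈ C} · ∫ w dμ]`: the Mecke identity for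
`g(μ, y) = 1_C(μ, y) w(y)`, whose re-rooted value is `g(θ_y μ, -y) = 1_{(μ, 0) ∈ C} w(y)`, and
`lintegral_const_mul`. [folklore] -/
theorem stub_covariantMecke :
    ∀ P : Measure (Measure (EuclideanSpace ℝ (Fin 3))), IsPointStationaryLaw P →
      ∀ C : Set (Measure (EuclideanSpace ℝ (Fin 3)) × EuclideanSpace ℝ (Fin 3)), MeasurableSet C →
        (∀ (μ : Measure (EuclideanSpace ℝ (Fin 3))) (y : EuclideanSpace ℝ (Fin 3)),
          (Measure.map (fun z => z - y) μ, -y) ∈ C ↔ (μ, (0 : EuclideanSpace ℝ (Fin 3))) ∈ C) →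
        ∀ w : EuclideanSpace ℝ (Fin 3) → ℝ≥0∞, Measurable w → (∀ y, w (-y) = w y) →
          ∫⁻ μ, ∫⁻ y, C.indicator (fun p => w p.2) (μ, y) ∂μ ∂P =
            ∫⁻ μ, {μ' : Measure (EuclideanSpace ℝ (Fin 3)) | (μ', (0 : EuclideanSpace ℝ (Fin 3))) ∈ C}.indicator
              (fun _ => (1 : ℝ≥0∞)) μ * ∫⁻ y, w y ∂μ ∂P := by
  intro P hstat C hC hcov w hw heven
  -- joint measurability of the covariant mark `g(μ, y) = 1_C(μ, y) · w(y)`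
  have hgm : Measurable (Function.uncurry fun (μ : Measure (EuclideanSpace ℝ (Fin 3)))
      (y : EuclideanSpace ℝ (Fin 3)) => C.indicator (fun p => w p.2) (μ, y)) := by
    have h : (Function.uncurry fun (μ : Measure (EuclideanSpace ℝ (Fin 3)))
        (y : EuclideanSpace ℝ (Fin 3)) => C.indicator (fun p => w p.2) (μ, y)) =
        C.indicator (fun p => w p.2) := by
      funext ⟨μ, y⟩
      rfl
    rw [h]
    exact (hw.comp measurable_snd).indicator hC
  -- the Mecke identity for `g`, then pointwise identification of the re-rooted mark
  rw [hstat _ hgm]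
  refine lintegral_congr fun μ => ?_
  rw [← lintegral_const_mul _ hw]
  refine lintegral_congr fun y => ?_
  by_cases h0 : (μ, (0 : EuclideanSpace ℝ (Fin 3))) ∈ C
  · rw [Set.indicator_of_mem ((hcov μ y).2 h0),
      Set.indicator_of_mem (show μ ∈ {μ' : Measure (EuclideanSpace ℝ (Fin 3)) |
        (μ', (0 : EuclideanSpace ℝ (Fin 3))) ∈ C} from h0), one_mul]
    exact heven y
  · rw [Set.indicator_of_notMem (fun h => h0 ((hcov μ y).1 h)),
      Set.indicator_of_notMem (show μ ∉ {μ' : Measure (EuclideanSpace ℝ (Fin 3)) |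
        (μ', (0 : EuclideanSpace ℝ (Fin 3))) ∈ C} from h0), zero_mul]

end Summit.AtomisticToContinuum.Crystallization.Theorems.PalmGoodLaw.CovariantMecke

end
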